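import Literature.NumberTheory.LFunctions.MatomakiRadziwillTaoTheorem17
import Literature.NumberTheory.LFunctions.MatomakiRadziwillTaoKeyEstimateWith
import HarnessLib

/-!
# Matomäki–Radziwiłł–Tao 2015, Theorem 1.7 (with `e^{-M/120}`) from Theorem A.2 with an abstract middle term

Topic `Literature/NumberTheory/LFunctions`.  Everything in this file is PROVED; no definitions, no named facts.
The hA2-dependent statements of `MatomakiRadziwillTaoTheorem17.lean` (`windows_full_le`, `theorem17_mainRegime`,
Theorem 1.7) re-run from the hypothesis schema `MRT2015.TheoremA2With mid` (`MatomakiRadziwillTaoTheoremA2With.lean`)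
through `MRT2015.A2With.keyEstimate_typ` (`MatomakiRadziwillTaoKeyEstimateWith.lean`) with `κ = 12`: the major arcs
are run under `W ≤ e^{M/12}` (Matomäki–Radziwiłł–Tao: `W ≤ e^{M/3}`), which any middle term with
`√(mid(12 log W - 48)) ≤ C_m W^{-5/4}` affords — e.g. `mid M = C (1+M) e^{-M/2}` (Halász for block-restricted
sums) or `e^{-M/4}` — at the price of `log H₀ = M e^{M/120}` and the rate `e^{-M/120}` in Theorem 1.7
(`e^{-M/20}` as printed).  For Tao 2016, Proposition 2.4 (`M ≥ A/2 → ∞`) the rate is immaterial.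

* `MRT2015.A2With.windows_full_le` (hypothesis `60 log log L ≤ M(g; X, log⁵ L)`),
  `MRT2015.A2With.theorem17_mainRegime`, `MRT2015.A2With.theorem17With`.

The proofs are those of the tree verbatim with `15 ↦ 60`, `M/20 ↦ M/120`, `21/20 ↦ 121/120`.

## References
* K. Matomäki, M. Radziwiłł, T. Tao, Algebra & Number Theory 9 (2015), §2 (proof of Theorem 1.7), Theorem 1.7.
  [cite: MatomakiRadziwillTao2015, Theorem 1.7]
-/

noncomputable section

open Finset Real
open scoped Classical FourierTransform

namespace Literature.NumberTheory.LFunctions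

namespace MRT2015

namespace A2With

/-- Threshold: `120 log M ≤ M` for `M ≥ M₀`. [folklore] -/
theorem exists_threshold_M120 : ∃ M₀ : ℝ, ∀ M : ℝ, M₀ ≤ M → 120 * Real.log M ≤ M := by
  have ht := Real.tendsto_pow_log_div_mul_add_atTop 1 0 1 one_ne_zero
  have he := ht.eventually (gt_mem_nhds (show (0 : ℝ) < 1 / 120 by norm_num))
  obtain ⟨M₀, hM₀⟩ := Filter.eventually_atTop.mp (he.and (Filter.eventually_gt_atTop (0 : ℝ)))
  refine ⟨M₀, fun M hM => ?_⟩
  obtain ⟨h1, h2⟩ := hM₀ M hM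
  rw [one_mul, add_zero, pow_one, div_lt_iff₀ h2] at h1
  linarith

set_option maxHeartbeats 1600000 in
/-- **The window family of the full function in the regime `W = log⁵ L`** ([MRT2015, §2, proof
of Theorem 1.7, case `H ≤ H₀`]): for `1`-bounded multiplicative `g`, `L ≥ L₀`,
`log L ≤ (log X)^{1/625}` and `M(g; X, log⁵ L) ≥ 60 log log L` (schema `TheoremA2With mid`, `κ = 12`),
`∑_{x ≤ X₃} |∑_{x < n ≤ x+L} g(n) e(αn)| ≤ C L X₃ log log L / log L` (`X ≤ X₃ ≤ 2X`, `X ≥ X_*`):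
Theorem 2.3 (`keyEstimate_typ` with `V = log L`) for the typical part and Lemma 2.2
(`lemma22`) for the rest; proof of `MRT2015.windows_full_le` verbatim. [cite: MatomakiRadziwillTao2015, §2 (proof of Theorem 1.7)] -/
theorem windows_full_le {mid : ℝ → ℝ} (hmid0 : ∀ M : ℝ, 0 ≤ M → 0 ≤ mid M)
    (hanti : ∀ a b : ℝ, 1 ≤ a → a ≤ b → mid b ≤ mid a) (hA2 : TheoremA2With mid)
    {Cm W₁ : ℝ} (hCm : 0 ≤ Cm)
    (hdecay : ∀ W : ℝ, W₁ ≤ W → Real.sqrt (mid (12 * Real.log W - 48)) ≤ Cm * W ^ (-(5 : ℝ) / 4)) :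
    ∃ C L₀ Xs : ℝ, 0 < C ∧ ∀ (X X₃ : ℝ) (L : ℕ) (α : ℝ) (g : ArithmeticFunction ℂ),
      g.IsMultiplicative → (∀ n, ‖g n‖ ≤ 1) →
      Xs ≤ X → X ≤ X₃ → X₃ ≤ 2 * X → L₀ ≤ L →
      Real.log L ≤ Real.log X ^ (1 / 625 : ℝ) →
      60 * Real.log (Real.log L) ≤ Sieve.nonpretentiousness g X (Real.log L ^ 5) →
      ∑ x ∈ range (⌊X₃⌋₊ + 1), ‖∑ n ∈ Ioc x (x + L), g n * (𝐞 (α * n) : ℂ)‖ ≤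
        C * L * X₃ * (Real.log (Real.log L) / Real.log L) := by
  obtain ⟨C₁, W₁', X₁, hC₁, hkey⟩ := A2With.keyEstimate_typ hmid0 hanti hA2 (κ := 12) (by norm_num) hCm hdecay
  obtain ⟨C₂, X₂, hC₂, h22⟩ := lemma22
  obtain ⟨L₁, hL₁⟩ := exists_threshold_L
  refine ⟨C₁ + 2000 * C₂ + 1, max L₁ (Real.exp (max W₁' 3)), max (max X₁ X₂) (Real.exp 5776),
    by positivity, ?_⟩
  intro X X₃ L α g hgm hg1 hXs hXX₃ hX₃ hL₀ hLX hM
  -- thresholds in `L`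
  obtain ⟨hl_e2, hl_1015, hl_30⟩ := hL₁ L ((le_max_left _ _).trans hL₀)
  have hLexpW : Real.exp (max W₁' 3) ≤ L := (le_max_right _ _).trans hL₀
  have hL0 : (0 : ℝ) < L := (Real.exp_pos _).trans_le hLexpW
  set lam : ℝ := Real.log L with hlam
  have hl_W : max W₁' 3 ≤ lam := by
    rw [hlam, ← Real.log_exp (max W₁' 3)]; exact Real.log_le_log (Real.exp_pos _) hLexpW
  have hl_3 : 3 ≤ lam := (le_max_right _ _).trans hl_W
  have hl_7 : 7 ≤ lam := by
    have h := Real.exp_one_gt_d9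
    have e : Real.exp 2 = Real.exp 1 * Real.exp 1 := by rw [← Real.exp_add]; norm_num
    have : (7 : ℝ) ≤ Real.exp 2 := by rw [e]; nlinarith
    exact this.trans hl_e2
  have hl_1 : 1 ≤ lam := by linarith
  have hl_0 : 0 < lam := by linarith
  have hloglam : 2 ≤ Real.log lam := by
    rw [← Real.log_exp 2]; exact Real.log_le_log (Real.exp_pos 2) hl_e2
  have hLexp : (L : ℝ) = Real.exp lam := by rw [hlam, Real.exp_log hL0]
  -- thresholds in `X`
  have hX₁ : X₁ ≤ X := ((le_max_left _ _).trans (le_max_left _ _)).trans hXs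
  have hX₂ : X₂ ≤ X := ((le_max_right _ _).trans (le_max_left _ _)).trans hXs
  have hXe : Real.exp 5776 ≤ X := (le_max_right _ _).trans hXs
  have hX0 : 0 < X := (Real.exp_pos _).trans_le hXe
  set u : ℝ := Real.log X with hu
  have hu5776 : 5776 ≤ u := by
    rw [hu, ← Real.log_exp 5776]; exact Real.log_le_log (Real.exp_pos _) hXe
  have hu16 : 16 ≤ u := by linarith
  have hu1 : 1 ≤ u := by linarith
  have hu0 : 0 < u := by linarith
  have hXexp : X = Real.exp u := by rw [hu, Real.exp_log hX0]
  obtain ⟨hr1, hr2, hr3⟩ := rpow_small_le_sqrt hu16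
  -- `W = λ⁵`
  set W : ℝ := lam ^ 5 with hW
  have hW1 : 1 ≤ W := one_le_pow₀ hl_1
  have hl_W' : lam ≤ W := le_self_pow₀ hl_1 (by norm_num)
  have hV₀ : W₁' ≤ lam := (le_max_left _ _).trans hl_W
  have hW3 : 3 ≤ W := hl_3.trans hl_W'
  have hW0 : 0 < W := by linarith
  -- the hypotheses of Theorem 2.3 (`keyEstimate_typ` with `V = λ`)
  have hV1015 : lam ^ 1015 ≤ (L : ℝ) := by
    have : 0 ≤ lam ^ 1015 := by positivity
    linarith
  have hl_u : lam ≤ u ^ (1 / 625 : ℝ) := hLX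
  have hWu : lam ^ 5 ≤ u ^ (1 / 125 : ℝ) := by
    have : (u ^ (1 / 625 : ℝ)) ^ 5 = u ^ (1 / 125 : ℝ) := by
      rw [← Real.rpow_natCast, ← Real.rpow_mul hu0.le]; norm_num
    rw [← this]
    exact pow_le_pow_left₀ hl_0.le hl_u 5
  have hLW15 : (L : ℝ) * lam ^ 75 ≤ X := by
    -- `log (L λ^75) = λ + 75 log λ ≤ 4 λ ≤ 4 u^{1/625} ≤ u`
    have e1 : (L : ℝ) * lam ^ 75 = Real.exp (lam + 75 * Real.log lam) := by
      rw [Real.exp_add, ← hLexp,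
        show (75 : ℝ) * Real.log lam = Real.log (lam ^ 75) by rw [Real.log_pow]; norm_num,
        Real.exp_log (by positivity)]
    rw [e1, hXexp, Real.exp_le_exp]
    have h1 : Real.log lam ≤ lam / 30 := by
      have := hl_30; rw [hlam] at this ⊢; linarith
    nlinarith
  have hLexp2 : (L : ℝ) ≤ Real.exp (Real.sqrt (Real.log X / 2)) := by
    rw [hLexp, Real.exp_le_exp, ← hu]
    exact hl_u.trans hr3
  have hM3 : 5 * 12 * Real.log lam ≤ Sieve.nonpretentiousness g X (lam ^ 5) := by
    have := hM; rw [hlam] at *; linarith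
  have hT := hkey X X₃ lam L α g hgm hg1 hX₁ hXX₃ hX₃ hV₀ (by rw [hu] at hWu; exact hWu) hV1015
    hLW15 hLexp2 (by rw [hlam]) hM3
  -- Lemma 2.2 for the non-typical integers `≤ X₃`
  have hX₃1 : (1 : ℝ) ≤ X₃ := le_trans (by linarith [Real.add_one_le_exp (5776 : ℝ)]) (hXe.trans hXX₃)
  have hX₃0 : (0 : ℝ) < X₃ := by linarith
  have hLX' : (L : ℝ) ≤ X := by
    have : (L : ℝ) ≤ L * lam ^ 75 := le_mul_of_one_le_right hL0.le (one_le_pow₀ hl_1)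
    exact this.trans hLW15
  have hP10 : (10 : ℝ) < W ^ 200 := by
    calc (10 : ℝ) < 3 ^ 3 := by norm_num
      _ ≤ W ^ 3 := pow_le_pow_left₀ (by norm_num) hW3 3
      _ ≤ W ^ 200 := pow_le_pow_right₀ hW1 (by norm_num)
  have hPQ : W ^ 200 < (L : ℝ) / W ^ 3 := by
    rw [lt_div_iff₀ (by positivity)]
    calc W ^ 200 * W ^ 3 = W ^ 203 := by ring
      _ < (L : ℝ) := by
          rw [hW, ← pow_mul]; norm_num
          have : 0 < lam ^ 1015 := by positivity
          linarith
  have hQX₃ : (L : ℝ) / W ^ 3 ≤ X₃ := (div_le_self hL0.le (one_le_pow₀ hW1)).trans (hLX'.trans hXX₃)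
  have hsqrt : Real.sqrt X₃ ≤ X₃ := by
    rw [Real.sqrt_le_left (by linarith)]
    nlinarith
  have hQX₀ : (L : ℝ) / W ^ 3 ≤ Real.exp (Real.sqrt (Real.log (Real.sqrt X₃))) := by
    rw [Real.log_sqrt hX₃0.le]
    calc (L : ℝ) / W ^ 3 ≤ L := div_le_self hL0.le (one_le_pow₀ hW1)
      _ ≤ Real.exp (Real.sqrt (Real.log X / 2)) := hLexp2
      _ ≤ Real.exp (Real.sqrt (Real.log X₃ / 2)) := by
          have := Real.log_le_log hX0 hXX₃
          gcongr
  have hE := h22 X₃ (W ^ 200) (L / W ^ 3) (Real.sqrt X₃) (hX₂.trans hXX₃) hP10 hPQ hQX₃ le_rfl hsqrt hQX₀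
  -- the ratio `log P₁ / log Q₁ ≤ 2000 log λ / λ`
  have hratio : Real.log (W ^ 200) / Real.log ((L : ℝ) / W ^ 3) ≤ 2000 * (Real.log lam / lam) := by
    have e1 : Real.log (W ^ 200) = 1000 * Real.log lam := by
      rw [Real.log_pow, hW, Real.log_pow]; push_cast; ring
    have e2 : Real.log ((L : ℝ) / W ^ 3) = lam - 15 * Real.log lam := by
      rw [Real.log_div hL0.ne' (by positivity), hW, ← pow_mul, Real.log_pow, ← hlam]
      push_cast; ring
    rw [e1, e2]
    have h30 : 30 * Real.log lam ≤ lam := by have := hl_30; rwa [hlam] at this ⊢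
    have hden : lam / 2 ≤ lam - 15 * Real.log lam := by linarith
    have hlog0 : 0 ≤ Real.log lam := by linarith
    calc 1000 * Real.log lam / (lam - 15 * Real.log lam) ≤ 1000 * Real.log lam / (lam / 2) :=
          div_le_div_of_nonneg_left (by positivity) (by positivity) hden
      _ = 2000 * (Real.log lam / lam) := by field_simp; ring
  -- decomposition `g = 1_𝒮 g + 1_{𝒮ᶜ} g` window by window
  set N : ℕ := ⌊X₃⌋₊ with hN
  set S : Finset ℕ := typicalSet (W ^ 200) ((L : ℝ) / W ^ 3) (Real.sqrt X₃) X₃ with hSdef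
  have hwin : ∀ x ∈ range (N + 1), ‖∑ n ∈ Ioc x (x + L), g n * (𝐞 (α * n) : ℂ)‖ ≤
      ‖∑ n ∈ Ioc x (x + L), typFun g (W ^ 200) (L / W ^ 3) (Real.sqrt X₃) X₃ n * (𝐞 (α * n) : ℂ)‖ +
        ((#((Ioc x (x + L)).filter (fun n => N < n)) : ℝ) +
          #((Ioc x (x + L)).filter (fun n => n ≤ N ∧
            ¬ IsTypical (W ^ 200) ((L : ℝ) / W ^ 3) (Real.sqrt X₃) n))) := by
    intro x _
    have e : ∑ n ∈ Ioc x (x + L), g n * (𝐞 (α * n) : ℂ) =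
        ∑ n ∈ Ioc x (x + L), typFun g (W ^ 200) (L / W ^ 3) (Real.sqrt X₃) X₃ n * (𝐞 (α * n) : ℂ) +
        ∑ n ∈ Ioc x (x + L), (if n ∈ S then 0 else g n) * (𝐞 (α * n) : ℂ) := by
      rw [← Finset.sum_add_distrib]
      refine Finset.sum_congr rfl fun n _ => ?_
      simp only [typFun, ← hSdef]
      split_ifs <;> ring
    rw [e]
    refine (norm_add_le _ _).trans (add_le_add le_rfl ?_)
    rw [Finset.card_filter, Finset.card_filter]
    push_cast
    rw [← Finset.sum_add_distrib]
    refine (norm_sum_le _ _).trans (Finset.sum_le_sum fun n hn => ?_)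
    rw [Finset.mem_Ioc] at hn
    by_cases hS : n ∈ S
    · simp only [hS, if_true, zero_mul, norm_zero]
      positivity
    · rw [if_neg hS, norm_mul]
      have h1 : ‖g n‖ * ‖(𝐞 (α * n) : ℂ)‖ ≤ 1 :=
        mul_le_one₀ (hg1 n) (norm_nonneg _) (norm_fourierChar_le_one _)
      have h2 : (1 : ℝ) ≤ (if N < n then 1 else 0) + (if n ≤ N ∧
          ¬ IsTypical (W ^ 200) ((L : ℝ) / W ^ 3) (Real.sqrt X₃) n then 1 else 0) := by
        by_cases hNn : N < n
        · rw [if_pos hNn]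
          have : (0 : ℝ) ≤ (if n ≤ N ∧ ¬ IsTypical (W ^ 200) ((L : ℝ) / W ^ 3) (Real.sqrt X₃) n
            then 1 else 0) := by positivity
          linarith
        · push Not at hNn
          have hnt : ¬ IsTypical (W ^ 200) ((L : ℝ) / W ^ 3) (Real.sqrt X₃) n := by
            intro ht
            exact hS (mem_typicalSet.mpr ⟨⟨by omega, hNn⟩, ht⟩)
          rw [if_neg (not_lt.mpr hNn), if_pos ⟨hNn, hnt⟩]
          norm_num
      linarith
  -- summing over `x`
  have hL2 : ((L : ℝ)) ^ 2 ≤ L * X₃ / lam := by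
    rw [le_div_iff₀ hl_0, sq, mul_assoc]
    refine mul_le_mul_of_nonneg_left ?_ hL0.le
    calc (L : ℝ) * lam ≤ L * lam ^ 75 :=
          mul_le_mul_of_nonneg_left (le_self_pow₀ hl_1 (by norm_num)) hL0.le
      _ ≤ X := hLW15
      _ ≤ X₃ := hXX₃
  have hlogdiv : 1 / lam ≤ Real.log lam / lam :=
    div_le_div_of_nonneg_right (by linarith) hl_0.le
  calc ∑ x ∈ range (N + 1), ‖∑ n ∈ Ioc x (x + L), g n * (𝐞 (α * n) : ℂ)‖
      ≤ ∑ x ∈ range (N + 1), (‖∑ n ∈ Ioc x (x + L),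
          typFun g (W ^ 200) (L / W ^ 3) (Real.sqrt X₃) X₃ n * (𝐞 (α * n) : ℂ)‖ +
        ((#((Ioc x (x + L)).filter (fun n => N < n)) : ℝ) +
          #((Ioc x (x + L)).filter (fun n => n ≤ N ∧
            ¬ IsTypical (W ^ 200) ((L : ℝ) / W ^ 3) (Real.sqrt X₃) n)))) := Finset.sum_le_sum hwin
    _ ≤ C₁ * L * X₃ / lam + ((L : ℝ) ^ 2 +
        L * (C₂ * (Real.log (W ^ 200) / Real.log ((L : ℝ) / W ^ 3)) * X₃)) := by
        rw [Finset.sum_add_distrib, Finset.sum_add_distrib]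
        refine add_le_add hT (add_le_add
          (sum_card_overshoot_le N L) ((sum_card_not_typical_le _ _ _ N L).trans
            (mul_le_mul_of_nonneg_left hE (Nat.cast_nonneg L))))
    _ ≤ C₁ * L * X₃ / lam + (L * X₃ / lam + L * (C₂ * (2000 * (Real.log lam / lam)) * X₃)) := by
        gcongr
    _ ≤ (C₁ + 2000 * C₂ + 1) * L * X₃ * (Real.log lam / lam) := by
        have h0 : 0 ≤ (L : ℝ) * X₃ := by positivity
        have k1 := mul_le_mul_of_nonneg_left hlogdiv h0
        have k2 := mul_le_mul_of_nonneg_left hlogdiv (mul_nonneg hC₁.le h0)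
        have e : (C₁ + 2000 * C₂ + 1) * L * X₃ * (Real.log lam / lam) =
            C₁ * (L * X₃) * (Real.log lam / lam) + 2000 * C₂ * (L * X₃) * (Real.log lam / lam) +
              L * X₃ * (Real.log lam / lam) := by ring
        rw [e]
        have e2 : C₁ * L * X₃ / lam = C₁ * (L * X₃) * (1 / lam) := by ring
        have e3 : (L : ℝ) * X₃ / lam = L * X₃ * (1 / lam) := by ring
        have e4 : (L : ℝ) * (C₂ * (2000 * (Real.log lam / lam)) * X₃) =
            2000 * C₂ * (L * X₃) * (Real.log lam / lam) := by ring
        rw [e2, e3, e4]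
        linarith


set_option maxHeartbeats 3200000 in
/-- **Theorem 1.7, main regime, from the schema `TheoremA2With mid` (`κ = 12`)** (`X`, `H`, `M` large): the discrete window families of the
integral are `≤ C (e^{-M/20} + log log H / log H + log^{-1/700} X) H X`, where `M` is any lower
bound for `M(g; X, W)` at all levels `1 ≤ W ≤ min(log^{1/125} X, log⁵ H)`.  As printed: the two
window lengths `⌊H⌋, ⌊H⌋ + 1` are split into `m = max(2, ⌈2(⌊H⌋+1)/σ⌉)` balanced pieces,
`log σ = min(log^{1/700} X · log log X, M e^{M/20})`; each piece length `s` is admissible for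
`windows_full_le` (`L₀ ≤ s`, `log s ≤ log^{1/625} X`, `60 log log s ≤ M ≤ M(g; X, log⁵ s)`), and
`log log s / log s ≤ 5 (e^{-M/20} + log log H / log H + log^{-1/700} X)`.
[cite: MatomakiRadziwillTao2015, §2 (proof of Theorem 1.7)] -/
theorem theorem17_mainRegime {mid : ℝ → ℝ} (hmid0 : ∀ M : ℝ, 0 ≤ M → 0 ≤ mid M)
    (hanti : ∀ a b : ℝ, 1 ≤ a → a ≤ b → mid b ≤ mid a) (hA2 : TheoremA2With mid)
    {Cm W₁ : ℝ} (hCm : 0 ≤ Cm)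
    (hdecay : ∀ W : ℝ, W₁ ≤ W → Real.sqrt (mid (12 * Real.log W - 48)) ≤ Cm * W ^ (-(5 : ℝ) / 4)) :
    ∃ C Hh Uh Mh : ℝ, 0 < C ∧ ∀ (g : ArithmeticFunction ℂ), g.IsMultiplicative → (∀ n, ‖g n‖ ≤ 1) →
      ∀ (X H : ℝ), 3 ≤ H → H ≤ X → Hh ≤ H → Uh ≤ Real.log X → ∀ M' : ℝ, Mh ≤ M' →
      (∀ W : ℝ, 1 ≤ W → W ≤ Real.log X ^ (1 / 125 : ℝ) → W ≤ Real.log H ^ 5 →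
        M' ≤ Sieve.nonpretentiousness g X W) →
      ∀ α : ℝ, ∑ k ∈ range ⌈X⌉₊, (‖∑ n ∈ Ioc k (k + ⌊H⌋₊), g n * (𝐞 (α * n) : ℂ)‖ +
          (if k + ⌊H⌋₊ + 1 ≤ ⌊X + H⌋₊ then ‖∑ n ∈ Ioc k (k + ⌊H⌋₊ + 1), g n * (𝐞 (α * n) : ℂ)‖
            else 0)) ≤
        C * (Real.exp (-M' / 120) + Real.log (Real.log H) / Real.log H +
          1 / Real.log X ^ (1 / 700 : ℝ)) * H * X := by
  obtain ⟨C₀, L₀, Xs, hC₀, hwin⟩ := windows_full_le hmid0 hanti hA2 hCm hdecay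
  obtain ⟨U₁, hU₁1, hU₁⟩ := exists_threshold_u
  obtain ⟨M₁, hM₁⟩ := exists_threshold_M120
  obtain ⟨he3, hlog12⟩ := exp_one_le_three_and_log_twelve
  set Lmin : ℝ := max L₀ 16 with hLmin
  have hLmin16 : (16 : ℝ) ≤ Lmin := le_max_right _ _
  have hLminL₀ : L₀ ≤ Lmin := le_max_left _ _
  set Wreq : ℝ := max (Real.log (12 * Lmin)) 6 with hWreq
  have hWreq6 : (6 : ℝ) ≤ Wreq := le_max_right _ _
  refine ⟨100 * C₀, Real.exp Wreq, max (max U₁ 16) (max (Real.log Xs) (Real.exp Wreq)),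
    max (max M₁ 1) Wreq, by positivity, ?_⟩
  intro g hgm hg1 X H hH3 hHX hHh hUh M' hMh hlevel α
  -- sizes of `X`, `H`, `M'`
  set u : ℝ := Real.log X with hu
  have hX0 : 0 < X := by linarith
  have hXu : X = Real.exp u := by rw [hu, Real.exp_log hX0]
  have hU₁u : U₁ ≤ u := ((le_max_left _ _).trans (le_max_left _ _)).trans hUh
  have hu16 : (16 : ℝ) ≤ u := ((le_max_right _ _).trans (le_max_left _ _)).trans hUh
  have hu1 : (1 : ℝ) ≤ u := by linarith
  have hu0 : (0 : ℝ) < u := by linarith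
  have hlogu : Real.log u ≤ u ^ (3 / 17500 : ℝ) := hU₁ u hU₁u
  have hlogu0 : 0 < Real.log u := Real.log_pos (by linarith)
  have hXsX : Xs ≤ X := by
    rcases le_or_gt Xs 0 with h | h
    · linarith
    · have : Real.log Xs ≤ u := ((le_max_left _ _).trans (le_max_right _ _)).trans hUh
      rw [hu] at this
      exact (Real.log_le_log_iff h hX0).mp this
  have huW : Real.exp Wreq ≤ u := ((le_max_right _ _).trans (le_max_right _ _)).trans hUh
  have hlogu_W : Wreq ≤ Real.log u := by
    rw [← Real.log_exp Wreq]; exact Real.log_le_log (Real.exp_pos _) huW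
  have hH0 : (0 : ℝ) < H := by linarith
  have hlogH : Wreq ≤ Real.log H := by
    rw [← Real.log_exp Wreq]; exact Real.log_le_log (Real.exp_pos _) hHh
  have hlogH6 : (6 : ℝ) ≤ Real.log H := hWreq6.trans hlogH
  have hM₁M : M₁ ≤ M' := ((le_max_left _ _).trans (le_max_left _ _)).trans hMh
  have hM1 : (1 : ℝ) ≤ M' := ((le_max_right _ _).trans (le_max_left _ _)).trans hMh
  have hM0 : (0 : ℝ) < M' := by linarith
  have hMW : Wreq ≤ M' := (le_max_right _ _).trans hMh
  have hlogM : 120 * Real.log M' ≤ M' := hM₁ M' hM₁M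
  -- the cap `σ = exp ℓ₀`
  set ℓX : ℝ := u ^ (1 / 700 : ℝ) * Real.log u with hℓX
  set ℓM : ℝ := M' * Real.exp (M' / 120) with hℓM
  set ℓ₀ : ℝ := min ℓX ℓM with hℓ₀
  set σ : ℝ := Real.exp ℓ₀ with hσ
  have hu700 : 1 ≤ u ^ (1 / 700 : ℝ) := Real.one_le_rpow hu1 (by norm_num)
  have hℓXW : Wreq ≤ ℓX := hlogu_W.trans (le_mul_of_one_le_left hlogu0.le hu700)
  have hℓMW : Wreq ≤ ℓM := hMW.trans (le_mul_of_one_le_right hM0.le (Real.one_le_exp (by positivity)))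
  have hℓ₀W : Wreq ≤ ℓ₀ := le_min hℓXW hℓMW
  have hℓ₀6 : (6 : ℝ) ≤ ℓ₀ := hWreq6.trans hℓ₀W
  have hℓ₀0 : 0 < ℓ₀ := by linarith
  have hσ2 : (2 : ℝ) ≤ σ := by
    rw [hσ]; exact le_trans (by linarith [Real.add_one_le_exp (6:ℝ)]) (Real.exp_le_exp.mpr hℓ₀6)
  have hσ0 : 0 < σ := by linarith
  have hlogσ : Real.log σ = ℓ₀ := by rw [hσ, Real.log_exp]
  have h12Lmin : Real.log (12 * Lmin) ≤ Wreq := le_max_left _ _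
  have hσL : 12 * Lmin ≤ σ := by
    rw [hσ, ← Real.exp_log (show 0 < 12 * Lmin by positivity)]
    exact Real.exp_le_exp.mpr (h12Lmin.trans hℓ₀W)
  have hHL : 12 * Lmin ≤ H := by
    rw [← Real.exp_log (show 0 < 12 * Lmin by positivity), ← Real.exp_log hH0]
    exact Real.exp_le_exp.mpr (h12Lmin.trans hlogH)
  -- `ℓ₀ ≤ ℓX ≤ u^{1/625}`
  have hℓXu : ℓX ≤ u ^ (1 / 625 : ℝ) := by
    calc ℓX ≤ u ^ (1 / 700 : ℝ) * u ^ (3 / 17500 : ℝ) := mul_le_mul_of_nonneg_left hlogu (by positivity)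
      _ = u ^ (1 / 625 : ℝ) := by rw [← Real.rpow_add hu0]; norm_num
  -- the three small quantities
  set E₁ : ℝ := Real.exp (-M' / 120) with hE₁
  set E₂ : ℝ := Real.log (Real.log H) / Real.log H with hE₂
  set E₃ : ℝ := 1 / u ^ (1 / 700 : ℝ) with hE₃
  have hE₁0 : 0 < E₁ := Real.exp_pos _
  have hE₂0 : 0 ≤ E₂ := div_nonneg (Real.log_nonneg (by linarith)) (by linarith)
  have hE₃0 : 0 < E₃ := by positivity
  -- `log ℓ₀ / ℓ₀ ≤ 2 E₃ + (21/20) E₁`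
  have hrateℓ₀ : Real.log ℓ₀ / ℓ₀ ≤ 2 * E₃ + 121 / 120 * E₁ := by
    have hX' : Real.log ℓX / ℓX ≤ 2 * E₃ := by
      have hℓX0 : 0 < ℓX := by positivity
      have h1 : Real.log ℓX ≤ 2 * Real.log u := by
        rw [hℓX, Real.log_mul (by positivity) hlogu0.ne', Real.log_rpow hu0]
        have := Real.log_le_sub_one_of_pos hlogu0
        nlinarith
      calc Real.log ℓX / ℓX ≤ 2 * Real.log u / ℓX := div_le_div_of_nonneg_right h1 hℓX0.le
        _ = 2 * E₃ := by rw [hℓX, hE₃]; field_simp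
    have hM'' : Real.log ℓM / ℓM ≤ 121 / 120 * E₁ := by
      have hℓM0 : 0 < ℓM := by positivity
      have h1 : Real.log ℓM ≤ 121 / 120 * M' := by
        rw [hℓM, Real.log_mul hM0.ne' (Real.exp_pos _).ne', Real.log_exp]
        have := Real.log_le_sub_one_of_pos hM0
        linarith
      calc Real.log ℓM / ℓM ≤ 121 / 120 * M' / ℓM := div_le_div_of_nonneg_right h1 hℓM0.le
        _ = 121 / 120 * E₁ := by
            rw [hℓM, hE₁, show -M' / 120 = -(M' / 120) by ring, Real.exp_neg]
            field_simp
    have hnonnegX : 0 ≤ Real.log ℓX / ℓX :=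
      div_nonneg (Real.log_nonneg (by linarith)) (by linarith)
    have hnonnegM : 0 ≤ Real.log ℓM / ℓM :=
      div_nonneg (Real.log_nonneg (by linarith)) (by linarith)
    rcases min_choice ℓX ℓM with h | h <;> rw [hℓ₀, h] <;> linarith
  -- `w = min (log H) ℓ₀ ≥ 6`, and `log w / w ≤ E₂ + log ℓ₀/ℓ₀`
  set w : ℝ := min (Real.log H) ℓ₀ with hw
  have hw6 : (6 : ℝ) ≤ w := le_min hlogH6 hℓ₀6
  have hratew : Real.log w / w ≤ E₂ + (2 * E₃ + 121 / 120 * E₁) := by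
    have h1 : 0 ≤ Real.log ℓ₀ / ℓ₀ := div_nonneg (Real.log_nonneg (by linarith)) hℓ₀0.le
    rcases min_choice (Real.log H) ℓ₀ with h | h <;> rw [hw, h]
    · rw [← hE₂]; linarith
    · linarith
  -- the rate at any `v ≥ w/2`: `log v / v ≤ 5 E`
  have hrate : ∀ v : ℝ, w / 2 ≤ v → Real.log v / v ≤ 5 * (E₁ + E₂ + E₃) := by
    intro v hv
    have h1 : Real.log v / v ≤ Real.log (w / 2) / (w / 2) :=
      log_div_self_le_of_le (by linarith) hv
    have h2 : Real.log (w / 2) / (w / 2) ≤ 2 * (Real.log w / w) := by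
      have hw0 : 0 < w := by linarith
      have : Real.log (w / 2) ≤ Real.log w := Real.log_le_log (by linarith) (by linarith)
      rw [div_div_eq_mul_div]
      calc Real.log (w / 2) * 2 / w ≤ Real.log w * 2 / w :=
            div_le_div_of_nonneg_right (by nlinarith) hw0.le
        _ = 2 * (Real.log w / w) := by ring
    nlinarith [hE₁0.le, hE₂0, hE₃0.le]
  -- the balanced pieces
  set t₀ : ℕ := ⌊H⌋₊ with ht₀
  have ht₀H : (t₀ : ℝ) ≤ H := Nat.floor_le hH0.le
  have hHt₀ : H < t₀ + 1 := Nat.lt_floor_add_one H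
  set m : ℕ := max 2 ⌈2 * ((t₀ : ℝ) + 1) / σ⌉₊ with hm
  set N : ℕ := ⌊X + H⌋₊ with hN
  -- admissibility and the bound for one piece family
  have hpiece : ∀ t : ℕ, t₀ ≤ t → t ≤ t₀ + 1 → ∀ s : ℕ, (s = t / m ∨ s = t / m + 1) →
      ∑ y ∈ range (N + 1), ‖∑ n ∈ Ioc y (y + s), g n * (𝐞 (α * n) : ℂ)‖ ≤
        20 * C₀ * ((t / m : ℕ) : ℝ) * X * (E₁ + E₂ + E₃) := by
    intro t ht ht' s hs
    obtain ⟨hm0, hsσ, hst, hslow⟩ := pieces_size hσ2 ht ht' hm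
    set s₀ : ℕ := t / m with hs₀
    -- `s₀ ≥ min(H, σ)/12 ≥ Lmin`
    have hmin : min H σ / 12 ≤ (s₀ : ℝ) := by
      have h1 : min H σ - 1 ≤ min (t₀ : ℝ) σ := by
        rcases min_choice (t₀ : ℝ) σ with h | h <;> rw [h]
        · linarith [min_le_left H σ]
        · linarith [min_le_right H σ]
      have h2 : 12 * Lmin ≤ min H σ := le_min hHL hσL
      have : (14 : ℝ) ≤ min H σ := by linarith
      linarith
    have hs₀L : Lmin ≤ (s₀ : ℝ) := by
      have : 12 * Lmin ≤ min H σ := le_min hHL hσL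
      linarith
    have hs₀16 : (16 : ℝ) ≤ s₀ := hLmin16.trans hs₀L
    have hs₀0 : (0 : ℝ) < s₀ := by linarith
    -- `s` versus `s₀`
    have hss₀ : (s₀ : ℝ) ≤ s ∧ (s : ℝ) ≤ s₀ + 1 := by
      rcases hs with rfl | rfl
      · exact ⟨le_rfl, by linarith⟩
      · push_cast; exact ⟨by linarith, le_rfl⟩
    have hs16 : (16 : ℝ) ≤ s := hs₀16.trans hss₀.1
    have hs0 : (0 : ℝ) < s := by linarith
    have hsL₀ : L₀ ≤ (s : ℝ) := hLminL₀.trans (hs₀L.trans hss₀.1)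
    have hsσ' : (s : ℝ) ≤ σ := by linarith [hss₀.2]
    have hsH : (s : ℝ) ≤ H := by
      have : (t : ℝ) ≤ t₀ + 1 := by exact_mod_cast ht'
      linarith [hss₀.2]
    -- `log s ≤ ℓ₀ ≤ u^{1/625}`
    have hlogs : Real.log s ≤ ℓ₀ := by
      rw [← hlogσ]; exact Real.log_le_log hs0 hsσ'
    have hlogs1 : 1 ≤ Real.log s := by
      have : Real.exp 1 ≤ s := by linarith
      rw [← Real.log_exp 1]; exact Real.log_le_log (Real.exp_pos 1) this
    have hlogs_u : Real.log s ≤ u ^ (1 / 625 : ℝ) := hlogs.trans ((min_le_left _ _).trans hℓXu)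
    -- the level `W = log⁵ s`
    have hW1 : (1 : ℝ) ≤ Real.log s ^ 5 := one_le_pow₀ hlogs1
    have hWu : Real.log s ^ 5 ≤ u ^ (1 / 125 : ℝ) := by
      have : (u ^ (1 / 625 : ℝ)) ^ 5 = u ^ (1 / 125 : ℝ) := by
        rw [← Real.rpow_natCast, ← Real.rpow_mul hu0.le]; norm_num
      rw [← this]
      exact pow_le_pow_left₀ (by linarith) hlogs_u 5
    have hWH : Real.log s ^ 5 ≤ Real.log H ^ 5 :=
      pow_le_pow_left₀ (by linarith) (Real.log_le_log hs0 hsH) 5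
    have hMlevel : M' ≤ Sieve.nonpretentiousness g X (Real.log s ^ 5) := hlevel _ hW1 hWu hWH
    have hloglog : 60 * Real.log (Real.log s) ≤ Sieve.nonpretentiousness g X (Real.log s ^ 5) := by
      refine le_trans ?_ hMlevel
      have h1 : Real.log (Real.log s) ≤ Real.log ℓ₀ := Real.log_le_log (by linarith) hlogs
      have h2 : Real.log ℓ₀ ≤ Real.log ℓM := Real.log_le_log hℓ₀0 (min_le_right _ _)
      have h3 : Real.log ℓM = Real.log M' + M' / 120 := by
        rw [hℓM, Real.log_mul hM0.ne' (Real.exp_pos _).ne', Real.log_exp]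
      linarith
    -- Layer A for `s`
    have hXH : X ≤ X + H := by linarith
    have hXH2 : X + H ≤ 2 * X := by linarith
    have hA := hwin X (X + H) s α g hgm hg1 hXsX hXH hXH2 hsL₀ hlogs_u hloglog
    -- the rate at `s`
    have hrate_s : Real.log (Real.log s) / Real.log s ≤ 5 * (E₁ + E₂ + E₃) := by
      refine hrate _ ?_
      -- `log s ≥ log s₀ ≥ log (min H σ / 12) = log (min H σ) - log 12 ≥ w - 3 ≥ w/2`
      have h1 : Real.log (min H σ / 12) ≤ Real.log s :=
        Real.log_le_log (by positivity) (hmin.trans hss₀.1)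
      have h2 : Real.log (min H σ / 12) = Real.log (min H σ) - Real.log 12 :=
        Real.log_div (by positivity) (by norm_num)
      have h3 : w ≤ Real.log (min H σ) := by
        rcases min_choice H σ with h | h <;> rw [h]
        · exact min_le_left _ _
        · rw [hlogσ]; exact min_le_right _ _
      linarith
    calc ∑ y ∈ range (N + 1), ‖∑ n ∈ Ioc y (y + s), g n * (𝐞 (α * n) : ℂ)‖
        ≤ C₀ * s * (X + H) * (Real.log (Real.log s) / Real.log s) := hA
      _ ≤ C₀ * (2 * s₀) * (2 * X) * (5 * (E₁ + E₂ + E₃)) := by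
          have h0 : 0 ≤ Real.log (Real.log s) / Real.log s :=
            div_nonneg (Real.log_nonneg hlogs1) (by linarith)
          have h1 : (s : ℝ) ≤ 2 * s₀ := by linarith [hss₀.2]
          have h2 : C₀ * s * (X + H) ≤ C₀ * (2 * s₀) * (2 * X) := by
            apply mul_le_mul (mul_le_mul_of_nonneg_left h1 hC₀.le) hXH2 (by positivity) (by positivity)
          exact mul_le_mul h2 hrate_s h0 (by positivity)
      _ = 20 * C₀ * (s₀ : ℝ) * X * (E₁ + E₂ + E₃) := by ring
  -- the two families
  have hm0 : 0 < m := by rw [hm]; exact lt_of_lt_of_le (by norm_num) (le_max_left _ _)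
  have hfam : ∀ t K : ℕ, t₀ ≤ t → t ≤ t₀ + 1 → K + t ≤ N + 1 →
      ∑ k ∈ range K, ‖∑ n ∈ Ioc k (k + t), g n * (𝐞 (α * n) : ℂ)‖ ≤
        20 * C₀ * t * X * (E₁ + E₂ + E₃) := by
    intro t K ht ht' hK
    have h := family_split_le (fun n => g n * (𝐞 (α * n) : ℂ)) hm0 hK
      (B := 20 * C₀ * ((t / m : ℕ) : ℝ) * X * (E₁ + E₂ + E₃)) (fun s hs => hpiece t ht ht' s hs)
    refine h.trans ?_
    have hms : (m : ℝ) * ((t / m : ℕ) : ℝ) ≤ t := by exact_mod_cast Nat.mul_div_le t m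
    have h0 : 0 ≤ 20 * C₀ * X * (E₁ + E₂ + E₃) := by positivity
    calc (m : ℝ) * (20 * C₀ * ((t / m : ℕ) : ℝ) * X * (E₁ + E₂ + E₃))
        = (m * ((t / m : ℕ) : ℝ)) * (20 * C₀ * X * (E₁ + E₂ + E₃)) := by ring
      _ ≤ t * (20 * C₀ * X * (E₁ + E₂ + E₃)) := mul_le_mul_of_nonneg_right hms h0
      _ = 20 * C₀ * t * X * (E₁ + E₂ + E₃) := by ring
  -- family 1: `t = t₀`, `K = ⌈X⌉`
  have hK1 : ⌈X⌉₊ + t₀ ≤ N + 1 := by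
    have h1 : (⌈X⌉₊ : ℝ) < X + 1 := Nat.ceil_lt_add_one hX0.le
    have h2 : X + H < (N : ℝ) + 1 := Nat.lt_floor_add_one (X + H)
    have : ((⌈X⌉₊ + t₀ : ℕ) : ℝ) < (N : ℝ) + 2 := by push_cast; linarith
    have : ⌈X⌉₊ + t₀ < N + 2 := by exact_mod_cast this
    omega
  have hF1 := hfam t₀ ⌈X⌉₊ le_rfl (Nat.le_succ _) hK1
  -- family 2: `t = t₀ + 1`, `K = N - t₀`
  have ht₀N : t₀ ≤ N := Nat.floor_le_floor (by linarith)
  have hK2 : (N - t₀) + (t₀ + 1) ≤ N + 1 := by omega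
  have hF2 := hfam (t₀ + 1) (N - t₀) (Nat.le_succ _) le_rfl hK2
  have hF2' : ∑ k ∈ range ⌈X⌉₊, (if k + t₀ + 1 ≤ N then
      ‖∑ n ∈ Ioc k (k + t₀ + 1), g n * (𝐞 (α * n) : ℂ)‖ else 0) ≤
      20 * C₀ * ((t₀ + 1 : ℕ) : ℝ) * X * (E₁ + E₂ + E₃) := by
    refine le_trans ?_ hF2
    rw [← Finset.sum_filter]
    simp_rw [add_assoc]
    refine Finset.sum_le_sum_of_subset_of_nonneg ?_ (fun _ _ _ => norm_nonneg _)
    intro k hk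
    rw [Finset.mem_filter] at hk
    rw [Finset.mem_range]; omega
  -- conclusion
  have hE : 0 ≤ E₁ + E₂ + E₃ := by positivity
  calc ∑ k ∈ range ⌈X⌉₊, (‖∑ n ∈ Ioc k (k + t₀), g n * (𝐞 (α * n) : ℂ)‖ +
        (if k + t₀ + 1 ≤ N then ‖∑ n ∈ Ioc k (k + t₀ + 1), g n * (𝐞 (α * n) : ℂ)‖ else 0))
      ≤ 20 * C₀ * t₀ * X * (E₁ + E₂ + E₃) + 20 * C₀ * ((t₀ + 1 : ℕ) : ℝ) * X * (E₁ + E₂ + E₃) := by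
        rw [Finset.sum_add_distrib]; exact add_le_add hF1 hF2'
    _ = 20 * C₀ * X * (E₁ + E₂ + E₃) * (2 * t₀ + 1) := by push_cast; ring
    _ ≤ 20 * C₀ * X * (E₁ + E₂ + E₃) * (3 * H) := by
        refine mul_le_mul_of_nonneg_left ?_ (by positivity)
        have h1 : (t₀ : ℝ) ≤ H := ht₀H
        have h2 : (3 : ℝ) ≤ H := hH3
        linarith
    _ = 60 * C₀ * (E₁ + E₂ + E₃) * H * X := by ring
    _ ≤ 100 * C₀ * (E₁ + E₂ + E₃) * H * X := by
        have : 0 ≤ C₀ * (E₁ + E₂ + E₃) * H * X := by positivity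
        nlinarith

set_option maxHeartbeats 1600000 in
/-- **Theorem 1.7 with `e^{-M/120}`, from the schema `TheoremA2With mid` (`κ = 12`).**  For `1`-bounded
multiplicative `g` and `X ≥ H ≥ 10`,
`sup_α ∫_0^X |∑_{x≤n≤x+H} g(n)e(αn)| dx ≤ C (e^{-M(g;X,Q)/120} + log log H/log H + log^{-1/700} X) HX`,
`Q = min(log^{1/125} X, log⁵ H)` — the statement of the named fact `MatomakiRadziwillTao2015_theorem17` with
`e^{-M/20}` replaced by `e^{-M/120}` (which is what the hypothesis `W ≤ e^{M/12}` of the major arcs, in place of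
the printed `W ≤ e^{M/3}`, affords: `log H₀ = M e^{M/120}`).  Proof of
`MRT2015.MatomakiRadziwillTao2015_theorem17_of_theoremA2` verbatim. [cite: MatomakiRadziwillTao2015, Theorem 1.7] -/
theorem theorem17With {mid : ℝ → ℝ} (hmid0 : ∀ M : ℝ, 0 ≤ M → 0 ≤ mid M)
    (hanti : ∀ a b : ℝ, 1 ≤ a → a ≤ b → mid b ≤ mid a) (hA2 : TheoremA2With mid)
    {Cm W₁ : ℝ} (hCm : 0 ≤ Cm)
    (hdecay : ∀ W : ℝ, W₁ ≤ W → Real.sqrt (mid (12 * Real.log W - 48)) ≤ Cm * W ^ (-(5 : ℝ) / 4)) :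
    ∃ C : ℝ, ∀ g : ArithmeticFunction ℂ, g.IsMultiplicative → (∀ n, ‖g n‖ ≤ 1) →
      ∀ X H : ℝ, 10 ≤ H → H ≤ X → ∀ α : ℝ,
        ∫ x in (0 : ℝ)..X,
            ‖∑ n ∈ Icc ⌈x⌉₊ ⌊x + H⌋₊, g n * Complex.exp (2 * Real.pi * Complex.I * (α : ℂ) * (n : ℂ))‖
          ≤ C * (Real.exp (-(Sieve.nonpretentiousness g X
                  (min (Real.log X ^ (1 / 125 : ℝ)) (Real.log H ^ (5 : ℝ)))) / 120)
                + Real.log (Real.log H) / Real.log H + 1 / Real.log X ^ (1 / 700 : ℝ)) * H * X := by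
  obtain ⟨C, Hh, Uh, Mh, hC, hmain⟩ := theorem17_mainRegime hmid0 hanti hA2 hCm hdecay
  set Hh' : ℝ := max Hh 10 with hHh'
  set Uh' : ℝ := max Uh 16 with hUh'
  have hHh'10 : (10 : ℝ) ≤ Hh' := le_max_right _ _
  have hUh'16 : (16 : ℝ) ≤ Uh' := le_max_right _ _
  set c₁ : ℝ := 1 / Uh' ^ (1 / 700 : ℝ) with hc₁
  set c₂ : ℝ := Real.log 2 / Real.log Hh' with hc₂
  set c₃ : ℝ := Real.exp (-Mh / 120) with hc₃
  have hc₁0 : 0 < c₁ := by positivity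
  have hlogHh' : 0 < Real.log Hh' := Real.log_pos (by linarith)
  have hlog2 : 0 < Real.log 2 := Real.log_pos (by norm_num)
  have hc₂0 : 0 < c₂ := div_pos hlog2 hlogHh'
  have hc₃0 : 0 < c₃ := Real.exp_pos _
  refine ⟨max C (max (2 / c₁) (max (2 / c₂) (2 / c₃))), ?_⟩
  intro g hgm hg1 X H h10 hHX α
  have hH0 : (0 : ℝ) < H := by linarith
  have hX0 : (0 : ℝ) < X := by linarith
  set u : ℝ := Real.log X with hu
  have hlogH2 : 2 ≤ Real.log H := two_le_log_of_ten_le h10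
  have hu2 : 2 ≤ u := (two_le_log_of_ten_le (h10.trans hHX))
  have hu0 : 0 < u := by linarith
  -- the window summand as `g n e(αn)`
  set c : ℕ → ℂ := fun n => g n * (𝐞 (α * n) : ℂ) with hcdef
  have hc0 : c 0 = 0 := by simp [hcdef]
  have hc1 : ∀ n, ‖c n‖ ≤ 1 := fun n => by
    rw [hcdef]; dsimp only; rw [norm_mul]
    exact mul_le_one₀ (hg1 n) (norm_nonneg _) (norm_fourierChar_le_one _)
  have hconv : ∀ x : ℝ, ‖∑ n ∈ Icc ⌈x⌉₊ ⌊x + H⌋₊,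
      g n * Complex.exp (2 * Real.pi * Complex.I * (α : ℂ) * (n : ℂ))‖ =
      ‖∑ n ∈ Icc ⌈x⌉₊ ⌊x + H⌋₊, c n‖ := by
    intro x; congr 1
    exact Finset.sum_congr rfl fun n _ => by rw [hcdef]; dsimp only; rw [fourierChar_natCast_eq_exp]
  simp_rw [hconv]
  -- the three small quantities
  set Q : ℝ := min (Real.log X ^ (1 / 125 : ℝ)) (Real.log H ^ (5 : ℝ)) with hQ
  set M' : ℝ := Sieve.nonpretentiousness g X Q with hM'
  set E₁ : ℝ := Real.exp (-M' / 120) with hE₁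
  set E₂ : ℝ := Real.log (Real.log H) / Real.log H with hE₂
  set E₃ : ℝ := 1 / Real.log X ^ (1 / 700 : ℝ) with hE₃
  have hE₁0 : 0 < E₁ := Real.exp_pos _
  have hE₂0 : 0 ≤ E₂ := div_nonneg (Real.log_nonneg (by linarith)) (by linarith)
  have hE₃0 : 0 < E₃ := by rw [hE₃, ← hu]; positivity
  have hE : 0 ≤ E₁ + E₂ + E₃ := by positivity
  have hgoal : ∀ {B : ℝ}, ∫ x in (0 : ℝ)..X, ‖∑ n ∈ Icc ⌈x⌉₊ ⌊x + H⌋₊, c n‖ ≤ B * (E₁ + E₂ + E₃) * H * X →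
      B ≤ max C (max (2 / c₁) (max (2 / c₂) (2 / c₃))) →
      ∫ x in (0 : ℝ)..X, ‖∑ n ∈ Icc ⌈x⌉₊ ⌊x + H⌋₊, c n‖ ≤
        max C (max (2 / c₁) (max (2 / c₂) (2 / c₃))) * (E₁ + E₂ + E₃) * H * X := by
    intro B h1 h2
    refine h1.trans ?_
    have : 0 ≤ (E₁ + E₂ + E₃) * H * X := by positivity
    calc B * (E₁ + E₂ + E₃) * H * X = B * ((E₁ + E₂ + E₃) * H * X) := by ring
      _ ≤ max C (max (2 / c₁) (max (2 / c₂) (2 / c₃))) * ((E₁ + E₂ + E₃) * H * X) :=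
          mul_le_mul_of_nonneg_right h2 this
      _ = _ := by ring
  -- the trivial bound `∫ ≤ (H + 2) X ≤ 2 H X`
  have htriv : ∫ x in (0 : ℝ)..X, ‖∑ n ∈ Icc ⌈x⌉₊ ⌊x + H⌋₊, c n‖ ≤ 2 * H * X := by
    have h1 : ∀ x ∈ Set.uIoc (0 : ℝ) X, ‖(‖∑ n ∈ Icc ⌈x⌉₊ ⌊x + H⌋₊, c n‖)‖ ≤ H + 2 := by
      intro x _
      rw [Real.norm_eq_abs, abs_of_nonneg (norm_nonneg _)]
      exact norm_sum_Icc_le hc1 hH0.le x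
    have h2 := intervalIntegral.norm_integral_le_of_norm_le_const h1
    rw [sub_zero, abs_of_pos hX0, Real.norm_eq_abs] at h2
    have h3 := (le_abs_self _).trans h2
    nlinarith
  -- small quantities force the trivial bound to suffice
  have hsmall : ∀ {cc : ℝ}, 0 < cc → cc ≤ E₁ + E₂ + E₃ → 2 / cc ≤ max C (max (2 / c₁) (max (2 / c₂) (2 / c₃))) →
      ∫ x in (0 : ℝ)..X, ‖∑ n ∈ Icc ⌈x⌉₊ ⌊x + H⌋₊, c n‖ ≤
        max C (max (2 / c₁) (max (2 / c₂) (2 / c₃))) * (E₁ + E₂ + E₃) * H * X := by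
    intro cc hcc hccE hle
    refine hgoal (htriv.trans ?_) hle
    have hHX0 : 0 ≤ H * X := by positivity
    have e : 2 / cc * (E₁ + E₂ + E₃) * H * X = (2 * H * X) * ((E₁ + E₂ + E₃) / cc) := by
      field_simp
    rw [e]
    refine le_mul_of_one_le_right (by positivity) ?_
    rwa [one_le_div hcc]
  by_cases hXbig : Uh' ≤ u
  · by_cases hHbig : Hh' ≤ H
    · by_cases hMbig : Mh ≤ M'
      · -- main regime
        have hlevel : ∀ W : ℝ, 1 ≤ W → W ≤ Real.log X ^ (1 / 125 : ℝ) → W ≤ Real.log H ^ 5 →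
            M' ≤ Sieve.nonpretentiousness g X W := by
          intro W hW1 hWu hWH
          refine nonpretentiousness_mono_level hg1 hX0.le hW1 (le_min hWu ?_)
          rwa [show (5 : ℝ) = ((5 : ℕ) : ℝ) by norm_num, Real.rpow_natCast]
        have h1 := integral_le_sum_windows hc0 hc1 hX0.le hH0.le (X := X) (H := H)
        have h2 := hmain g hgm hg1 X H (by linarith) hHX ((le_max_left _ _).trans hHbig)
          ((le_max_left _ _).trans hXbig) M' hMbig hlevel α
        exact hgoal (h1.trans h2) (le_max_left _ _)
      · -- `M'` small: `E₁ ≥ c₃`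
        push Not at hMbig
        refine hsmall hc₃0 ?_ ((le_max_right _ _).trans ((le_max_right _ _).trans (le_max_right _ _)))
        have : c₃ ≤ E₁ := by
          rw [hc₃, hE₁]; exact Real.exp_le_exp.mpr (by linarith)
        linarith
    · -- `H` small: `E₂ ≥ c₂`
      push Not at hHbig
      refine hsmall hc₂0 ?_ ((le_max_left _ _).trans ((le_max_right _ _).trans (le_max_right _ _)))
      have hlogH0 : 0 < Real.log H := by linarith
      have : c₂ ≤ E₂ := by
        rw [hc₂, hE₂]
        calc Real.log 2 / Real.log Hh' ≤ Real.log 2 / Real.log H :=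
              div_le_div_of_nonneg_left hlog2.le hlogH0 (Real.log_le_log hH0 hHbig.le)
          _ ≤ Real.log (Real.log H) / Real.log H :=
              div_le_div_of_nonneg_right (Real.log_le_log (by norm_num) hlogH2) hlogH0.le
      linarith
  · -- `X` small: `E₃ ≥ c₁`
    push Not at hXbig
    refine hsmall hc₁0 ?_ ((le_max_left _ _).trans (le_max_right _ _))
    have : c₁ ≤ E₃ := by
      rw [hc₁, hE₃, ← hu]
      exact div_le_div_of_nonneg_left zero_le_one (by positivity)
        (Real.rpow_le_rpow hu0.le hXbig.le (by norm_num))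
    linarith

end A2With

end MRT2015

end Literature.NumberTheory.LFunctions
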